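import Summits.QuantumFields.GaugeBoot.TiltedBoxEvenAxisRPTwoDimAnnuli
import Literature.MathematicalPhysics.QuantumFieldTheory.LatticeSiteRPMechanism
import HarnessLib

/-!
# Reduced-half site reflection positivity on the even square tilted box in two dimensions (gauge-boot, L3 supplement: 2D slab gluing, reduced-half site mirror 4b/4)

HONEST FRAMING (cell `pub-gaugeboot`, page 1 of every file): the venture produces certified bounds
on lattice expectations at stated coupling, gauge group, dimension and torus size; NOT a mass gap,
NOT a continuum limit, NOT a string tension; NOT Yang–Mills-summit-bearing (barriers
`FixedCouplingUltralocality`, `PerturbativeInvisibility`). A structural POSITIVE result about a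
reflection of a two-dimensional periodic box; it bounds no expectation of the venture's tables.

`TiltedBoxAxisRPNegative.lean` proved: on the square tilted box `ℤ^d/Γ(2P, 2P, L)` the in-plane SITE
mirror `Θ_i : x_i ↦ -x_i` is NOT of positive type for the closed half `{0 ≤ x_i ≤ P}` at ANY real `β`, in
EVERY `d ≥ 2` — the layer `x_i ≡ P` is mapped onto itself twisted by the half period `T`. This module
proves that the twisted layer is the ONLY obstruction in two dimensions:

* **`tiltedBox_axisRP_even_twoDim`** — two directions (`∀ k, k = i ∨ k = j`), `P ≥ 2`, every compact
  second countable `G`, every continuous `ρ`, EVERY real `β`: `0 ≤ ∫ conj F(Θ_i U) · F(U) dμ_β` for every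
  bounded measurable observable `F` of the REDUCED half `{0 ≤ x_i ≤ P - 1}` (`IsRedSiteLink`; the shape
  refuted for `P` in place of `P - 1` by `not_tiltedBox_axisRP`).

**Proof.** The reduced half leaves the twisted layer FREE; the layer `x_i ≡ 0` is shared and pointwise
fixed. The Boltzmann weight splits into `h = g·conj(g∘Θ_i)` (`g = F e^{-βE}`, `E = redSiteExpo`) and two
annulus products around the free layer (`boltzmann_split_even`); Migdal's recursion integrates their rungs,
one letter of the free word composes the two slab kernels into the two-layer kernel `K_ψ`
(`SlabKernelTwoLayer.lean`), the twist is a conjugation (`integral_hEv_annuli`); the Gram form of `K_ψ`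
turns the integral into `∫ (∫ Ψ_g conj(Ψ_g ∘ Θ_i) dμ₀) dg` with `Ψ_g = g · k_ψ(w_{P-1}, g)` an observable of
the shared and positive links, and the tree's mechanism
`LatticeRP.integral_splice_mul_conj_comp_of_shared_nonneg` (shared block = the `j`-links of the layer
`0`, fixed by `Θ_i`) makes each inner integral non-negative. No character expansion, no sign condition on `β`.

Consequence (separate module): two-dimensional tilted limit points along even boxes are site-RP along
both in-plane axes as well, hence EVERY two-dimensional tilted limit point is Class B. Small new positive
result; mechanism folklore (Migdal 1975, Osterwalder–Seiler 1978).

References: A. A. Migdal, Sov. Phys. JETP 42 (1975) 413; K. Osterwalder, E. Seiler, Ann. Phys. 110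
(1978) 440, §2; J. Fröhlich, R. Israel, E. H. Lieb, B. Simon, J. Stat. Phys. 22 (1980) 297, §3;
M. Biskup, in LNM 1970 (2009) §5.4–5.5.
-/

noncomputable section

open MeasureTheory Complex Function
open scoped ComplexOrder ComplexConjugate
open Literature.MathematicalPhysics.QuantumFieldTheory (haarProbability)
open Literature.MathematicalPhysics.QuantumFieldTheory.LatticeRP (piMeasure splice splice_eq_piecewise
  integral_splice_mul_conj_comp_of_shared_nonneg)
open Literature.RepresentationTheory.CompactGroups

namespace Summit.QuantumFields.GaugeBoot

namespace TiltedRP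

namespace TwoDim

variable {d : ℕ} {i j : Fin d} {L P N : ℕ} [NeZero L] [NeZero P]
variable {G : Type*} [Group G] [TopologicalSpace G] [IsTopologicalGroup G] [CompactSpace G]
  [MeasurableSpace G] [BorelSpace G] [SecondCountableTopology G]
variable (ρ : G →* Matrix (Fin N) (Fin N) ℂ)

/-! ## The main theorem -/

/-- The observable of the mechanism at the feature parameter `g`: `Ψ_g = g_ev · k_ψ(w_{P-1}, g)`. -/
def psiEv (β : ℝ) (F : Config (TiltedSite d i j (2 * P) (2 * P) L) d G → ℂ) (g : G) (U : Config (TiltedSite d i j (2 * P) (2 * P) L) d G) : ℂ :=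
  gEv ρ β F U * (SlabKernel.slabKernel (psiE P ρ β) (wA U) g : ℂ)

/-- **Pointwise in the feature parameter, the shared-block mechanism applies**:
`0 ≤ ∫ Ψ_g(U) conj Ψ_g(Θ_i U) dU`. [folklore] -/
theorem integral_psiEv_nonneg [DecidableEq (TiltedSite d i j (2 * P) (2 * P) L)] (hP : 2 ≤ P) (hij : i ≠ j)
    (hd : ∀ k : Fin d, k = i ∨ k = j) (hρ : Continuous ρ) (β : ℝ)
    {F : Config (TiltedSite d i j (2 * P) (2 * P) L) d G → ℂ} (hFm : Measurable F) {CF : ℝ} (hFb : ∀ U, ‖F U‖ ≤ CF)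
    (hFo : ∀ U V : Config (TiltedSite d i j (2 * P) (2 * P) L) d G, (∀ l, IsRedSiteLink l → U l = V l) → F U = F V) (g : G) :
    0 ≤ ∫ U, psiEv ρ β F g U * conj (psiEv ρ β F g (configReflect (tiltedUnit d i j (2 * P) (2 * P) L) i (tiltedAxisFlip d L (2 * P) hij) U))
      ∂(productHaar (TiltedSite d i j (2 * P) (2 * P) L) d G) := by
  haveI : IsProbabilityMeasure (haarProbability G) := CompactGroup.isProbabilityMeasure_haarMeasure_top
  have hAF : IsAxisFlip (tiltedUnit d i j (2 * P) (2 * P) L) i (tiltedAxisFlip d L (2 * P) hij) :=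
    isAxisFlip_tiltedAxisFlip d L (2 * P) hij
  obtain ⟨hgm, Cg, hgb⟩ := measurable_gEv_and_bound ρ hρ β hFm hFb
  have hψc : Continuous (psiE P ρ β) := SlabKernel.continuous_convPow (SlabKernel.continuous_wilsonWt ρ hρ β) _
  obtain ⟨Ck, hCk0, hCk⟩ := SlabKernel.exists_abs_slabKernel_le hψc
  obtain ⟨hwA, -, -⟩ := continuous_wordsE (L := L) (P := P) (i := i) (j := j) (d := d) (G := G)
  have hΨm : Measurable (psiEv ρ β F g) :=
    hgm.mul (Complex.measurable_ofReal.comp (((SlabKernel.continuous_uncurry_slabKernel hψc).comp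
      (hwA.prodMk continuous_const)).measurable))
  have hΨb : ∀ U, ‖psiEv ρ β F g U‖ ≤ Cg * Ck := fun U => by
    rw [psiEv, norm_mul, Complex.norm_real, Real.norm_eq_abs]
    exact mul_le_mul (hgb U) (hCk _ _) (abs_nonneg _) ((norm_nonneg _).trans (hgb U))
  have hΨdep : DependsOn (psiEv ρ β F g) ((posBlockE d i j L P ∪ ∅ ∪ shBlockE d i j L P : Finset _) : Set _) := by
    intro U V hUV
    have hbl : ∀ l, (l ∈ posBlockE d i j L P ∨ l ∈ shBlockE d i j L P) → U l = V l := fun l hl => by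
      refine hUV l ?_
      rw [Finset.union_empty, Finset.coe_union, Set.mem_union, Finset.mem_coe, Finset.mem_coe]
      exact hl
    have h1 : wA U = wA V := by
      unfold wA SlabKernel.oprod
      congr 1
      refine List.map_congr_left fun t _ => hbl _ (Or.inl (aLink_mem_posBlockE hP hij t))
    simp only [psiEv, gEv_eq_of_blocks ρ hP hij hd β hFo hbl, h1]
  have key := integral_splice_mul_conj_comp_of_shared_nonneg (haarProbability G) (shBlockE d i j L P)
    (posBlockE d i j L P) ∅ _ (hAF.measurePreserving_configReflect (G := G))
    (fun U l hl => configReflect_apply_of_mem_shBlockE hij U hl)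
    (fun l hl => dependsOn_configReflect_apply_even hP hij hd l hl) (disjoint_shBlockE_posBlockE hij)
    (Finset.disjoint_empty_right _) hΨm hΨb hΨdep
  simp only [splice_eq_piecewise, Finset.piecewise_empty] at key
  unfold productHaar
  rwa [integral_fun_fst (fun U => psiEv ρ β F g U * conj (psiEv ρ β F g (configReflect
      (tiltedUnit d i j (2 * P) (2 * P) L) i (tiltedAxisFlip d L (2 * P) hij) U))), probReal_univ, one_smul] at key

/-- **After the annuli: the Gram form of the two-layer kernel is non-negative**,
`0 ≤ ∫ h · K_ψ(w_{P-1}, w_{P-1}∘Θ_i) dμ₀` (Fubini over the feature parameter). [folklore] -/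
theorem integral_hEv_kernel_nonneg [DecidableEq (TiltedSite d i j (2 * P) (2 * P) L)] (hP : 2 ≤ P) (hij : i ≠ j)
    (hd : ∀ k : Fin d, k = i ∨ k = j) (hρ : Continuous ρ) (β : ℝ)
    {F : Config (TiltedSite d i j (2 * P) (2 * P) L) d G → ℂ} (hFm : Measurable F) {CF : ℝ} (hFb : ∀ U, ‖F U‖ ≤ CF)
    (hFo : ∀ U V : Config (TiltedSite d i j (2 * P) (2 * P) L) d G, (∀ l, IsRedSiteLink l → U l = V l) → F U = F V) :
    0 ≤ ∫ U, hEv ρ β F hij U * (SlabKernel.slabKernel₂ (psiE P ρ β) (wA U) (wA (configReflect (tiltedUnit d i j (2 * P) (2 * P) L) i (tiltedAxisFlip d L (2 * P) hij) U)) : ℂ)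
      ∂(productHaar (TiltedSite d i j (2 * P) (2 * P) L) d G) := by
  haveI : IsProbabilityMeasure (haarProbability G) := CompactGroup.isProbabilityMeasure_haarMeasure_top
  haveI : IsFiniteMeasure (productHaar (TiltedSite d i j (2 * P) (2 * P) L) d G) := by unfold productHaar; infer_instance
  have hAF : IsAxisFlip (tiltedUnit d i j (2 * P) (2 * P) L) i (tiltedAxisFlip d L (2 * P) hij) :=
    isAxisFlip_tiltedAxisFlip d L (2 * P) hij
  obtain ⟨hhm, Ch, hhb⟩ := measurable_hEv_and_bound ρ hij hρ β hFm hFb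
  have hψc : Continuous (psiE P ρ β) := SlabKernel.continuous_convPow (SlabKernel.continuous_wilsonWt ρ hρ β) _
  obtain ⟨hwA, -, -⟩ := continuous_wordsE (L := L) (P := P) (i := i) (j := j) (d := d) (G := G)
  have hΘc := continuous_configReflect_flip_even (L := L) (P := P) (G := G) hij
  rw [SlabKernel.integral_mul_slabKernel₂_eq (productHaar (TiltedSite d i j (2 * P) (2 * P) L) d G) (Φ := hEv ρ β F hij)
    (a := wA) (b := fun U => wA (configReflect (tiltedUnit d i j (2 * P) (2 * P) L) i (tiltedAxisFlip d L (2 * P) hij) U)) hψc hhm hhb hwA.measurable (hwA.comp hΘc).measurable]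
  refine integral_nonneg_of_complex fun g => ?_
  have key := integral_psiEv_nonneg ρ hP hij hd hρ β hFm hFb hFo g
  have heq : ∀ U, hEv ρ β F hij U * ((SlabKernel.slabKernel (psiE P ρ β) (wA U) g : ℂ) *
      (SlabKernel.slabKernel (psiE P ρ β) (wA (configReflect (tiltedUnit d i j (2 * P) (2 * P) L) i (tiltedAxisFlip d L (2 * P) hij) U)) g : ℂ)) =
      psiEv ρ β F g U * conj (psiEv ρ β F g (configReflect (tiltedUnit d i j (2 * P) (2 * P) L) i (tiltedAxisFlip d L (2 * P) hij) U)) := fun U => by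
    simp only [psiEv, hEv, map_mul, Complex.conj_ofReal]; ring
  simp_rw [heq]
  exact key

/-- **Reflection positivity of the SITE mirror of the EVEN square tilted box, for the REDUCED half, in two
dimensions.** On `ℤ^d/Γ(2P, 2P, L)` with `d = 2` directions (`∀ k, k = i ∨ k = j`), `P ≥ 2`, for a compact
second countable group `G`, a continuous matrix representation `ρ` and EVERY real `β`: for every bounded
measurable `F` reading only the links with both endpoints in `{0 ≤ x_i ≤ P - 1}` (`IsRedSiteLink`; the
twisted layer `x_i ≡ P` excluded), `0 ≤ ∫ conj F(Θ_i U) F(U) dμ_β(U)`, `Θ_i` the site mirror `x_i ↦ -x_i`.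
(With `P` in place of `P - 1` this fails at every `β` in every `d ≥ 2`: `not_tiltedBox_axisRP`.) Small new
positive result; 2D YM gluing across a free layer. -/
theorem tiltedBox_axisRP_even_twoDim (hP : 2 ≤ P) (hij : i ≠ j) (hd : ∀ k : Fin d, k = i ∨ k = j) (hρ : Continuous ρ)
    (β : ℝ) (F : Config (TiltedSite d i j (2 * P) (2 * P) L) d G → ℂ) (hFm : Measurable F)
    (hFb : ∃ C : ℝ, ∀ U, ‖F U‖ ≤ C)
    (hFo : ∀ U V : Config (TiltedSite d i j (2 * P) (2 * P) L) d G, (∀ l, IsRedSiteLink l → U l = V l) → F U = F V) :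
    0 ≤ ∫ U, conj (F (configReflect (tiltedUnit d i j (2 * P) (2 * P) L) i (tiltedAxisFlip d L (2 * P) hij) U)) * F U
      ∂(gibbs ρ (tiltedUnit d i j (2 * P) (2 * P) L) β) := by
  classical
  obtain ⟨CF, hFb⟩ := hFb
  -- Step 0: from the Wilson measure to the Boltzmann weight
  have hZ := normaliser_pos (A := TiltedSite d i j (2 * P) (2 * P) L) (G := G) ρ hρ (tiltedUnit d i j (2 * P) (2 * P) L) β
  rw [integral_gibbs]
  simp_rw [Complex.real_smul, Complex.ofReal_div, div_eq_mul_inv, mul_comm (Complex.ofReal _) ((_ : ℂ)⁻¹), mul_assoc]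
  rw [integral_const_mul]
  refine mul_nonneg (by rw [← Complex.ofReal_inv]; exact Complex.zero_le_real.2 (inv_nonneg.2 hZ.le)) ?_
  -- Steps 1–3: split, integrate the two annuli and the free letter, remove the twist; Step 4: Gram form
  simp_rw [boltzmann_split_even ρ hP hij hd hρ β F]
  rw [integral_const_mul]
  refine mul_nonneg (mul_nonneg (Complex.zero_le_real.2 (Real.exp_pos _).le) (Complex.zero_le_real.2 (Real.exp_pos _).le)) ?_
  rw [integral_hEv_annuli ρ hP hij hd hρ β hFm hFb hFo]
  exact integral_hEv_kernel_nonneg ρ hP hij hd hρ β hFm hFb hFo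

/-- **Corollary: the reduced-half site RP blocks of the even tilted box are positive semidefinite** (two
dimensions, every real `β`): for bounded measurable reduced-half observables `F_1, …, F_n` and `c ∈ ℂ^n`,
`0 ≤ ∑_{a,b} conj c_a · c_b · ⟨conj(F_a ∘ Θ_i) F_b⟩_β`. -/
theorem tiltedBox_axisRP_even_twoDim_blocks (hP : 2 ≤ P) (hij : i ≠ j) (hd : ∀ k : Fin d, k = i ∨ k = j)
    (hρ : Continuous ρ) (β : ℝ) {n : ℕ} (F : Fin n → Config (TiltedSite d i j (2 * P) (2 * P) L) d G → ℂ)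
    (hFm : ∀ a, Measurable (F a)) (hFb : ∀ a, ∃ C : ℝ, ∀ U, ‖F a U‖ ≤ C)
    (hFo : ∀ a, ∀ U V : Config (TiltedSite d i j (2 * P) (2 * P) L) d G, (∀ l, IsRedSiteLink l → U l = V l) → F a U = F a V)
    (c : Fin n → ℂ) :
    0 ≤ ∑ a, ∑ b, conj (c a) * c b *
      ∫ U, conj (F a (configReflect (tiltedUnit d i j (2 * P) (2 * P) L) i (tiltedAxisFlip d L (2 * P) hij) U)) * F b U
        ∂(gibbs ρ (tiltedUnit d i j (2 * P) (2 * P) L) β) := by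
  haveI := isProbabilityMeasure_gibbs (A := TiltedSite d i j (2 * P) (2 * P) L) (G := G) ρ hρ
    (tiltedUnit d i j (2 * P) (2 * P) L) β
  have hΘm : Measurable (configReflect (G := G) (tiltedUnit d i j (2 * P) (2 * P) L) i
      (tiltedAxisFlip d L (2 * P) hij)) :=
    ((isAxisFlip_tiltedAxisFlip d L (2 * P) hij).measurePreserving_configReflect (G := G)).measurable
  -- the combination `H = ∑_b c_b F_b`
  set H : Config (TiltedSite d i j (2 * P) (2 * P) L) d G → ℂ := fun U => ∑ b, c b * F b U with hH
  have hHm : Measurable H := Finset.measurable_sum _ fun b _ => (hFm b).const_mul _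
  choose C hC using hFb
  have hHb : ∃ K : ℝ, ∀ U, ‖H U‖ ≤ K := ⟨∑ b, ‖c b‖ * C b, fun U =>
    (norm_sum_le _ _).trans (Finset.sum_le_sum fun b _ => by
      rw [norm_mul]; exact mul_le_mul_of_nonneg_left (hC b U) (norm_nonneg _))⟩
  have hHo : ∀ U V : Config (TiltedSite d i j (2 * P) (2 * P) L) d G, (∀ l, IsRedSiteLink l → U l = V l) → H U = H V := fun U V hUV => by
    simp only [hH]
    exact Finset.sum_congr rfl fun b _ => by rw [hFo b U V hUV]
  have key := tiltedBox_axisRP_even_twoDim ρ hP hij hd hρ β H hHm hHb hHo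
  have hint : ∀ a b, Integrable (fun U => conj (F a (configReflect (tiltedUnit d i j (2 * P) (2 * P) L) i (tiltedAxisFlip d L (2 * P) hij) U)) * F b U) (gibbs ρ (tiltedUnit d i j (2 * P) (2 * P) L) β) :=
    fun a b => Integrable.of_bound
      (((Complex.continuous_conj.measurable.comp ((hFm a).comp hΘm)).mul (hFm b)).aestronglyMeasurable) (C a * C b)
      (ae_of_all _ fun U => by
        rw [norm_mul, Complex.norm_conj]
        exact mul_le_mul (hC a _) (hC b U) (norm_nonneg _) ((norm_nonneg (F a U)).trans (hC a U)))
  have hexp : ∫ U, conj (H (configReflect (tiltedUnit d i j (2 * P) (2 * P) L) i (tiltedAxisFlip d L (2 * P) hij) U)) * H U ∂(gibbs ρ (tiltedUnit d i j (2 * P) (2 * P) L) β) =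
      ∑ a, ∑ b, conj (c a) * c b * ∫ U, conj (F a (configReflect (tiltedUnit d i j (2 * P) (2 * P) L) i (tiltedAxisFlip d L (2 * P) hij) U)) * F b U
        ∂(gibbs ρ (tiltedUnit d i j (2 * P) (2 * P) L) β) := by
    have h1 : ∀ U, conj (H (configReflect (tiltedUnit d i j (2 * P) (2 * P) L) i (tiltedAxisFlip d L (2 * P) hij) U)) * H U =
        ∑ a, ∑ b, conj (c a) * c b * (conj (F a (configReflect (tiltedUnit d i j (2 * P) (2 * P) L) i (tiltedAxisFlip d L (2 * P) hij) U)) * F b U) := fun U => by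
      simp only [hH, map_sum, map_mul]
      rw [Finset.sum_mul_sum]
      exact Finset.sum_congr rfl fun a _ => Finset.sum_congr rfl fun b _ => by ring
    simp_rw [h1]
    rw [integral_finsetSum _ fun a _ => integrable_finsetSum _ fun b _ => (hint a b).const_mul _]
    refine Finset.sum_congr rfl fun a _ => ?_
    rw [integral_finsetSum _ fun b _ => (hint a b).const_mul _]
    exact Finset.sum_congr rfl fun b _ => integral_const_mul _ _
  rwa [hexp] at key

/-- **The two-dimensional statement, literally**: on `ℤ²/Γ(2P, 2P)` (`d = 2`, site mirror of the coordinate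
`x_0 ↦ -x_0`, mirror partner `x_1`), `P ≥ 2`, every compact second countable `G`, every continuous `ρ`,
every real `β`: the hybrid site mirror is reflection positive for the reduced half `{0 ≤ x_0 ≤ P - 1}`. -/
theorem tiltedBox_axisRP_even_fin_two (hP : 2 ≤ P) (hρ : Continuous ρ) (β : ℝ)
    (F : Config (TiltedSite 2 0 1 (2 * P) (2 * P) L) 2 G → ℂ) (hFm : Measurable F)
    (hFb : ∃ C : ℝ, ∀ U, ‖F U‖ ≤ C)
    (hFo : ∀ U V : Config (TiltedSite 2 0 1 (2 * P) (2 * P) L) 2 G, (∀ l, IsRedSiteLink l → U l = V l) → F U = F V) :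
    0 ≤ ∫ U, conj (F (configReflect (tiltedUnit 2 0 1 (2 * P) (2 * P) L) 0
        (tiltedAxisFlip 2 L (2 * P) Fin.zero_ne_one) U)) * F U
      ∂(gibbs ρ (tiltedUnit 2 0 1 (2 * P) (2 * P) L) β) :=
  tiltedBox_axisRP_even_twoDim ρ hP Fin.zero_ne_one (fun k => by fin_cases k <;> simp) hρ β F hFm hFb hFo

end TwoDim

end TiltedRP

end Summit.QuantumFields.GaugeBoot

end
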